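import Summits.AtomisticToContinuum.FouriersLaw.Theorems.EmbeddedDrudeMourreNessUniqueIBP
import Literature.MathematicalPhysics.KineticTheory.VelocityFlipNoise

/-!
# Resolvent identification of weak flip steady states, part 1: the pointwise equation and the entropy identity with a source

Helper file for crux `NoisyFourier` (stmt-AtomisticToContinuum-11977, route `VanishingNoiseTransfer`), line
`sector-dirichlet-gluing`, registered stub `stub_flipSteadyState_eq_bind_resolventKernel` (the lead's stub): a weak
steady state `μ = ρ dx` of the velocity-flip dynamics `L + εS` with a smooth density is `(μQ) R_{Nε}`. This part is
the integration-by-parts layer, the `ε > 0` twin of `EmbeddedDrudeMourreNessUniqueIBP.lean`: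

* `flip_revGenerator_add_eq_zero_of_weak` — a `C²` density `ρ` with `∫ (L φ + ε S φ) ρ dx = 0` for all `φ ∈ C_c^∞`
  solves POINTWISE `L̂ρ + 2γρ + ε Sρ = 0` (`L̂` the reversed-drift generator, `Lᵀ = L̂ + 2γ` the Lebesgue transpose of
  `L`, `S` Lebesgue-symmetric since the flips preserve Liouville measure);
* `integral_generator_mul_comp_eq_src`, `half_integral_weightedFisher_le_src` — the entropy-type identity and the
  weighted Fisher-information bound of the `ε = 0` file for a `C²` solution `ρ ≥ 0` of the INHOMOGENEOUS equation
  `L̂ρ + cρ + g = 0` with an arbitrary constant `c` and a continuous source `g`: the source only adds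
  `∫ a F'(ρ) |g|` to the bound (the profile slope `F'` is bounded in both uses).

No definitions.
-/

noncomputable section

open MeasureTheory Filter Topology Set
open scoped ContDiff NNReal ENNReal

namespace Summit.AtomisticToContinuum.FouriersLaw.Theorems.NoisyFourier.FlipResolvent

open Literature.MathematicalPhysics.KineticTheory.HeatConduction
open Literature.MathematicalPhysics.KineticTheory OscillatorChain
open Literature.Analysis.Distribution
open Summit.AtomisticToContinuum.FouriersLaw.Theorems.NessUnique

variable {N : ℕ} (P : OscillatorChain)

/-! ### The pointwise equation of a weak flip-stationary density -/

/-- `S ρ` is continuous for continuous `ρ`. [folklore] -/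
theorem continuous_flipNoise {ρ : PhaseSpace N → ℝ} (hρ : Continuous ρ) : Continuous (flipNoise N ρ) := by
  have e : flipNoise N ρ = fun x => ∑ i : Fin N, (ρ (momentumFlip i x) - ρ x) := funext (flipNoise_eq N ρ)
  rw [e]
  exact continuous_finsetSum _ fun i _ => (hρ.comp (continuous_momentumFlip i)).sub hρ

/-- **A weakly flip-stationary `C²` density solves `L̂ ρ + 2γ ρ + ε S ρ = 0` pointwise.** If `ρ ∈ C²` and
`∫ (L φ + ε S φ) ρ dx = 0` for every `φ ∈ C_c^∞` (`L = P.generator N T_L T_R`, smooth potentials, `N ≥ 1`,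
`γT_L, γT_R ≥ 0`), then `L̂ρ(x) + 2γρ(x) + ε Sρ(x) = 0` for every `x`: the Lebesgue transpose of `L` is `L̂ + 2γ`
(`integral_sdeGenerator_mul_eq`) and `S` is Lebesgue-symmetric (`integral_mul_flipNoise`, the flips preserve volume).
[cite: BernardinOlla2011, §2.1] -/
theorem flip_revGenerator_add_eq_zero_of_weak (hU : ContDiff ℝ ∞ P.U) (hV : ContDiff ℝ ∞ P.V) (hN : 0 < N)
    {T_L T_R : ℝ} (hL : 0 ≤ P.γ * T_L) (hR : 0 ≤ P.γ * T_R) (ε : ℝ) {ρ : PhaseSpace N → ℝ} (hρ : ContDiff ℝ 2 ρ)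
    (hweak : ∀ φ : PhaseSpace N → ℝ, ContDiff ℝ ∞ φ → HasCompactSupport φ →
      ∫ x, P.flipGenerator N T_L T_R ε φ x * ρ x = 0) (x : PhaseSpace N) :
    sdeGenerator (fun y => -P.drift N y) (P.bathVecL N T_L) (P.bathVecR N T_R) ρ x + 2 * P.γ * ρ x +
      ε * flipNoise N ρ x = 0 := by
  haveI := isAddHaarMeasure_volume_phaseSpace N
  set w : PhaseSpace N → ℝ := fun x =>
    sdeGenerator (fun y => -P.drift N y) (P.bathVecL N T_L) (P.bathVecR N T_R) ρ x + 2 * P.γ * ρ x +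
      ε * flipNoise N ρ x with hw
  have hρc : Continuous ρ := hρ.continuous
  have hwc : Continuous w :=
    (continuous_revGenerator_add P hU hV T_L T_R hρ).add (continuous_const.mul (continuous_flipNoise hρc))
  have hvol : ∀ i : Fin N, MeasurePreserving (momentumFlip i) (volume : Measure (PhaseSpace N)) volume :=
    fun i => measurePreserving_momentumFlip_volume i
  have horth : ∀ φ : PhaseSpace N → ℝ, ContDiff ℝ ∞ φ → HasCompactSupport φ →
      ∫ x, φ x • w x = 0 := by
    intro φ hφ hφc
    have hφ2 : ContDiff ℝ 2 φ := hφ.of_le (by norm_cast)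
    have hφcont : Continuous φ := hφ.continuous
    -- the Langevin part: `∫ φ (L̂ρ + 2γρ) = ∫ (Lφ) ρ`
    have h1 := integral_sdeGenerator_mul_eq P hU hV hN T_L T_R hφ2 hρ hφc
    rw [P.sdeGenerator_drift_eq_generator hN hL hR hφ2] at h1
    -- the flip part: `∫ φ (Sρ) = ∫ (Sφ) ρ`
    have hi0 : Integrable (fun x => φ x * ρ x) :=
      (hφcont.mul hρc).integrable_of_hasCompactSupport hφc.mul_right
    have hi : ∀ i : Fin N, Integrable (fun x => φ x * ρ (momentumFlip i x)) := fun i =>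
      (hφcont.mul (hρc.comp (continuous_momentumFlip i))).integrable_of_hasCompactSupport hφc.mul_right
    have h2 : ∫ x, φ x * flipNoise N ρ x = ∫ x, flipNoise N φ x * ρ x := integral_mul_flipNoise hvol hi0 hi
    -- integrability of the pieces
    have iA : Integrable (fun x => φ x * (sdeGenerator (fun y => -P.drift N y) (P.bathVecL N T_L)
        (P.bathVecR N T_R) ρ x + 2 * P.γ * ρ x)) :=
      (hφcont.mul (continuous_revGenerator_add P hU hV T_L T_R hρ)).integrable_of_hasCompactSupport hφc.mul_right
    have iB : Integrable (fun x => φ x * (ε * flipNoise N ρ x)) :=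
      (hφcont.mul (continuous_const.mul (continuous_flipNoise hρc))).integrable_of_hasCompactSupport hφc.mul_right
    have iC : Integrable (fun x => P.generator N T_L T_R φ x * ρ x) := by
      have hc : Continuous (P.generator N T_L T_R φ) :=
        P.continuous_generator (hU.of_le (by norm_cast)) (hV.of_le (by norm_cast)) N T_L T_R hφ2
      exact (hc.mul hρc).integrable_of_hasCompactSupport
        ((P.hasCompactSupport_generator N T_L T_R hφ2 hφc).mul_right)
    have hi' : ∀ i : Fin N, Integrable (fun x => φ (momentumFlip i x) * ρ x) := by
      intro i
      have hs : HasCompactSupport (fun x => φ (momentumFlip i x)) :=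
        hφc.comp_homeomorph
          (⟨⟨momentumFlip i, momentumFlip i, momentumFlip_momentumFlip i, momentumFlip_momentumFlip i⟩,
            continuous_momentumFlip i, continuous_momentumFlip i⟩ : PhaseSpace N ≃ₜ PhaseSpace N)
      exact ((hφcont.comp (continuous_momentumFlip i)).mul hρc).integrable_of_hasCompactSupport hs.mul_right
    have iD0 : Integrable (fun x => flipNoise N φ x * ρ x) := by
      have e : (fun x => flipNoise N φ x * ρ x) = fun x => ∑ i : Fin N, (φ (momentumFlip i x) * ρ x - φ x * ρ x) := by
        funext x; rw [flipNoise_eq, Finset.sum_mul]; simp only [sub_mul]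
      rw [e]
      exact integrable_finsetSum _ fun i _ => (hi' i).sub hi0
    have iD : Integrable (fun x => ε * (flipNoise N φ x * ρ x)) := iD0.const_mul ε
    have hB : ∫ x, φ x * (ε * flipNoise N ρ x) = ε * ∫ x, flipNoise N φ x * ρ x := by
      rw [← h2, ← integral_const_mul]
      refine integral_congr_ae (Eventually.of_forall fun x => ?_)
      ring
    calc ∫ x, φ x • w x = ∫ x, (φ x * (sdeGenerator (fun y => -P.drift N y) (P.bathVecL N T_L)
          (P.bathVecR N T_R) ρ x + 2 * P.γ * ρ x) + φ x * (ε * flipNoise N ρ x)) := by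
          refine integral_congr_ae (Eventually.of_forall fun x => ?_)
          simp only [hw, smul_eq_mul]; ring
      _ = (∫ x, P.generator N T_L T_R φ x * ρ x) + ε * ∫ x, flipNoise N φ x * ρ x := by
          rw [integral_add iA iB, ← h1, hB]
      _ = (∫ x, P.generator N T_L T_R φ x * ρ x) + ∫ x, ε * (flipNoise N φ x * ρ x) := by
          rw [integral_const_mul]
      _ = ∫ x, P.flipGenerator N T_L T_R ε φ x * ρ x := by
          rw [← integral_add iC iD]
          refine integral_congr_ae (Eventually.of_forall fun x => ?_)
          show P.generator N T_L T_R φ x * ρ x + ε * (flipNoise N φ x * ρ x) = P.flipGenerator N T_L T_R ε φ x * ρ x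
          rw [P.flipGenerator_eq_add_flipNoise]; ring
      _ = 0 := hweak φ hφ hφc
  have hae : ∀ᵐ x ∂(volume : Measure (PhaseSpace N)), w x = 0 :=
    ae_eq_zero_of_integral_contDiff_smul_eq_zero hwc.locallyIntegrable horth
  have hzero : w = 0 := (hwc.ae_eq_iff_eq (μ := volume) continuous_const).1 hae
  exact congrFun hzero x

/-! ### The entropy-type identity and the Fisher bound with a source term -/

/-- **The entropy-type identity with a source.** For smooth potentials, `N ≥ 1`, a `C²` solution `ρ` of
`L̂ρ + cρ + g = 0`, a compactly supported `C²` weight `a` and `F : ℝ → ℝ` with derivatives `F'`, `F''`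
(`F''` continuous):
`∫ (L a) F(ρ) dx = ∫ a (½ F''(ρ) Γ(ρ,ρ) - c (ρ F'(ρ) - F(ρ)) + (2γ - c) F(ρ) - F'(ρ) g) dx`. [folklore] -/
theorem integral_generator_mul_comp_eq_src (hU : ContDiff ℝ ∞ P.U) (hV : ContDiff ℝ ∞ P.V) (hN : 0 < N)
    (T_L T_R : ℝ) {ρ : PhaseSpace N → ℝ} (hρ : ContDiff ℝ 2 ρ) {c : ℝ} {g : PhaseSpace N → ℝ}
    (hpde : ∀ x, sdeGenerator (fun y => -P.drift N y) (P.bathVecL N T_L) (P.bathVecR N T_R) ρ x +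
      c * ρ x + g x = 0)
    {F F' F'' : ℝ → ℝ} (hF : ∀ u, HasDerivAt F (F' u) u) (hF' : ∀ u, HasDerivAt F' (F'' u) u)
    (hF'' : Continuous F'') {a : PhaseSpace N → ℝ} (ha : ContDiff ℝ 2 a) (hac : HasCompactSupport a) :
    ∫ x, sdeGenerator (P.drift N) (P.bathVecL N T_L) (P.bathVecR N T_R) a x * F (ρ x) =
      ∫ x, a x * ((1 / 2) * F'' (ρ x) *
          carreDuChamp (P.bathVecL N T_L) (P.bathVecR N T_R) ρ ρ x -
        c * (ρ x * F' (ρ x) - F (ρ x)) + (2 * P.γ - c) * F (ρ x) - F' (ρ x) * g x) := by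
  have hFρ : ContDiff ℝ 2 fun x => F (ρ x) := (contDiff_two_of_hasDerivAt hF hF' hF'').comp hρ
  rw [integral_sdeGenerator_mul_eq P hU hV hN T_L T_R ha hFρ hac]
  refine integral_congr_ae (Eventually.of_forall fun x => ?_)
  show a x * (sdeGenerator (fun y => -P.drift N y) (P.bathVecL N T_L) (P.bathVecR N T_R)
      (fun y => F (ρ y)) x + 2 * P.γ * F (ρ x)) = _
  rw [sdeGenerator_comp_eq (fun y => -P.drift N y) _ _ hF hF' hρ x]
  have h := hpde x
  have e : sdeGenerator (fun y => -P.drift N y) (P.bathVecL N T_L) (P.bathVecR N T_R) ρ x =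
      -(c * ρ x) - g x := by linarith
  rw [e]
  ring

/-- **The weighted Fisher-information bound with a source.** In the setting of
`integral_generator_mul_comp_eq_src`, assume moreover `0 ≤ a ≤ 1`, `|L a| ≤ K`, `ρ ≥ 0`, and that on `s ≥ 0`
the convex profile satisfies `0 ≤ F(s) ≤ ℓ θ(s)`, `0 ≤ s F'(s) - F(s) ≤ ℓ θ(s)`, `|F'(s)| ≤ B`, with `θ(ρ)`
integrable. Then
`½ ∫ a F''(ρ) Γ(ρ,ρ) dx ≤ ℓ (K + |c| + |2γ - c|) ∫ θ(ρ) dx + ∫ a |F'(ρ)| |g| dx`. [folklore] -/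
theorem half_integral_weightedFisher_le_src (hU : ContDiff ℝ ∞ P.U) (hV : ContDiff ℝ ∞ P.V) (hN : 0 < N)
    (T_L T_R : ℝ) {ρ : PhaseSpace N → ℝ} (hρ : ContDiff ℝ 2 ρ) (hρ0 : ∀ x, 0 ≤ ρ x)
    {c : ℝ} {g : PhaseSpace N → ℝ} (hg : Continuous g)
    (hpde : ∀ x, sdeGenerator (fun y => -P.drift N y) (P.bathVecL N T_L) (P.bathVecR N T_R) ρ x +
      c * ρ x + g x = 0)
    {F F' F'' : ℝ → ℝ} (hF : ∀ u, HasDerivAt F (F' u) u) (hF' : ∀ u, HasDerivAt F' (F'' u) u)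
    (hF'' : Continuous F'') {θ : ℝ → ℝ} {ℓ : ℝ}
    (hF0 : ∀ s, 0 ≤ s → 0 ≤ F s) (hFθ : ∀ s, 0 ≤ s → F s ≤ ℓ * θ s)
    (hG0 : ∀ s, 0 ≤ s → 0 ≤ s * F' s - F s) (hGθ : ∀ s, 0 ≤ s → s * F' s - F s ≤ ℓ * θ s)
    (hθint : Integrable fun x => θ (ρ x))
    {a : PhaseSpace N → ℝ} (ha : ContDiff ℝ 2 a) (hac : HasCompactSupport a)
    (ha0 : ∀ x, 0 ≤ a x) (ha1 : ∀ x, a x ≤ 1) {K : ℝ}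
    (hK : ∀ x, |sdeGenerator (P.drift N) (P.bathVecL N T_L) (P.bathVecR N T_R) a x| ≤ K) :
    (1 / 2) * ∫ x, a x * (F'' (ρ x) * carreDuChamp (P.bathVecL N T_L) (P.bathVecR N T_R) ρ ρ x) ≤
      ℓ * (K + |c| + |2 * P.γ - c|) * (∫ x, θ (ρ x)) + ∫ x, a x * (|F' (ρ x)| * |g x|) := by
  set vL := P.bathVecL N T_L
  set vR := P.bathVecR N T_R
  set La := sdeGenerator (P.drift N) vL vR a with hLa
  set Γ := carreDuChamp vL vR ρ ρ with hΓ
  have hYc : Continuous (P.drift N) := (P.contDiff_drift hU hV N).continuous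
  have hFc : Continuous F := continuous_iff_continuousAt.2 fun u => (hF u).continuousAt
  have hF'c : Continuous F' := continuous_iff_continuousAt.2 fun u => (hF' u).continuousAt
  have hρc : Continuous ρ := hρ.continuous
  have hρ1c : Continuous (fderiv ℝ ρ) := hρ.continuous_fderiv (by norm_num)
  have hΓc : Continuous Γ := by
    have e : Γ = fun y => fderiv ℝ ρ y vL * fderiv ℝ ρ y vL + fderiv ℝ ρ y vR * fderiv ℝ ρ y vR :=
      funext fun y => carreDuChamp_def vL vR ρ ρ y
    rw [e]
    exact ((hρ1c.clm_apply continuous_const).mul (hρ1c.clm_apply continuous_const)).add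
      ((hρ1c.clm_apply continuous_const).mul (hρ1c.clm_apply continuous_const))
  have hLac : Continuous La := continuous_sdeGenerator _ _ hYc ha
  have hLasupp : HasCompactSupport La := hasCompactSupport_sdeGenerator _ _ hac
  have hK0 : 0 ≤ K := (abs_nonneg _).trans (hK 0)
  -- integrability
  have i1 : Integrable (fun x => La x * F (ρ x)) :=
    (hLac.mul (hFc.comp hρc)).integrable_of_hasCompactSupport hLasupp.mul_right
  have i2 : Integrable (fun x => a x * ((1 / 2) * F'' (ρ x) * Γ x)) :=
    (ha.continuous.mul ((continuous_const.mul (hF''.comp hρc)).mul hΓc)).integrable_of_hasCompactSupport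
      hac.mul_right
  have i3 : Integrable (fun x => a x * (c * (ρ x * F' (ρ x) - F (ρ x)))) :=
    (ha.continuous.mul (continuous_const.mul ((hρc.mul (hF'c.comp hρc)).sub (hFc.comp hρc)))).integrable_of_hasCompactSupport
      hac.mul_right
  have i4 : Integrable (fun x => a x * ((2 * P.γ - c) * F (ρ x))) :=
    (ha.continuous.mul (continuous_const.mul (hFc.comp hρc))).integrable_of_hasCompactSupport hac.mul_right
  have i5 : Integrable (fun x => a x * (F' (ρ x) * g x)) :=
    (ha.continuous.mul ((hF'c.comp hρc).mul hg)).integrable_of_hasCompactSupport hac.mul_right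
  have i6 : Integrable (fun x => a x * (|F' (ρ x)| * |g x|)) :=
    (ha.continuous.mul ((hF'c.comp hρc).abs.mul hg.abs)).integrable_of_hasCompactSupport hac.mul_right
  -- the identity, rearranged
  have key0 := integral_generator_mul_comp_eq_src P hU hV hN T_L T_R hρ hpde hF hF' hF'' ha hac
  have i23 : Integrable (fun x => a x * ((1 / 2) * F'' (ρ x) * Γ x) - a x * (c * (ρ x * F' (ρ x) - F (ρ x)))) :=
    i2.sub i3
  have i234 : Integrable (fun x => a x * ((1 / 2) * F'' (ρ x) * Γ x) - a x * (c * (ρ x * F' (ρ x) - F (ρ x))) +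
      a x * ((2 * P.γ - c) * F (ρ x))) := i23.add i4
  have key : ∫ x, La x * F (ρ x) =
      (∫ x, a x * ((1 / 2) * F'' (ρ x) * Γ x)) - (∫ x, a x * (c * (ρ x * F' (ρ x) - F (ρ x)))) +
        (∫ x, a x * ((2 * P.γ - c) * F (ρ x))) - ∫ x, a x * (F' (ρ x) * g x) := by
    calc ∫ x, La x * F (ρ x)
        = ∫ x, (a x * ((1 / 2) * F'' (ρ x) * Γ x) - a x * (c * (ρ x * F' (ρ x) - F (ρ x))) +
            a x * ((2 * P.γ - c) * F (ρ x))) - a x * (F' (ρ x) * g x) := by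
          refine key0.trans (integral_congr_ae (Eventually.of_forall fun x => ?_))
          show a x * ((1 / 2) * F'' (ρ x) * carreDuChamp (P.bathVecL N T_L) (P.bathVecR N T_R) ρ ρ x -
              c * (ρ x * F' (ρ x) - F (ρ x)) + (2 * P.γ - c) * F (ρ x) - F' (ρ x) * g x) = _
          simp only [hΓ]
          ring
      _ = (∫ x, (a x * ((1 / 2) * F'' (ρ x) * Γ x) - a x * (c * (ρ x * F' (ρ x) - F (ρ x))) +
            a x * ((2 * P.γ - c) * F (ρ x)))) - ∫ x, a x * (F' (ρ x) * g x) := integral_sub i234 i5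
      _ = ((∫ x, (a x * ((1 / 2) * F'' (ρ x) * Γ x) - a x * (c * (ρ x * F' (ρ x) - F (ρ x))))) +
            ∫ x, a x * ((2 * P.γ - c) * F (ρ x))) - ∫ x, a x * (F' (ρ x) * g x) := by rw [integral_add i23 i4]
      _ = _ := by rw [integral_sub i2 i3]
  have e2 : (1 / 2) * ∫ x, a x * (F'' (ρ x) * Γ x) = ∫ x, a x * ((1 / 2) * F'' (ρ x) * Γ x) := by
    rw [← integral_const_mul]
    refine integral_congr_ae (Eventually.of_forall fun x => ?_)
    ring
  rw [e2]
  have h12 : ∫ x, a x * ((1 / 2) * F'' (ρ x) * Γ x) =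
      (∫ x, La x * F (ρ x)) + (∫ x, a x * (c * (ρ x * F' (ρ x) - F (ρ x)))) -
        (∫ x, a x * ((2 * P.γ - c) * F (ρ x))) + ∫ x, a x * (F' (ρ x) * g x) := by linarith
  rw [h12]
  -- bound the four terms
  have hb1 : ∫ x, La x * F (ρ x) ≤ ∫ x, K * (ℓ * θ (ρ x)) := by
    refine integral_mono i1 ((hθint.const_mul ℓ).const_mul K) fun x => ?_
    have hFx0 := hF0 _ (hρ0 x)
    have hFx := hFθ _ (hρ0 x)
    calc La x * F (ρ x) ≤ |La x| * F (ρ x) := mul_le_mul_of_nonneg_right (le_abs_self _) hFx0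
      _ ≤ K * (ℓ * θ (ρ x)) := mul_le_mul (hK x) hFx hFx0 hK0
  have hb2 : ∫ x, a x * (c * (ρ x * F' (ρ x) - F (ρ x))) ≤ ∫ x, |c| * (ℓ * θ (ρ x)) := by
    refine integral_mono i3 ((hθint.const_mul ℓ).const_mul |c|) fun x => ?_
    have hGx0 := hG0 _ (hρ0 x)
    have hGx := hGθ _ (hρ0 x)
    calc a x * (c * (ρ x * F' (ρ x) - F (ρ x))) ≤ |a x * (c * (ρ x * F' (ρ x) - F (ρ x)))| := le_abs_self _
      _ = a x * (|c| * (ρ x * F' (ρ x) - F (ρ x))) := by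
          rw [abs_mul, abs_mul, abs_of_nonneg (ha0 x), abs_of_nonneg hGx0]
      _ ≤ 1 * (|c| * (ρ x * F' (ρ x) - F (ρ x))) :=
          mul_le_mul_of_nonneg_right (ha1 x) (mul_nonneg (abs_nonneg c) hGx0)
      _ ≤ |c| * (ℓ * θ (ρ x)) := by rw [one_mul]; exact mul_le_mul_of_nonneg_left hGx (abs_nonneg c)
  have hb3 : -(∫ x, a x * ((2 * P.γ - c) * F (ρ x))) ≤ ∫ x, |2 * P.γ - c| * (ℓ * θ (ρ x)) := by
    rw [← integral_neg]
    refine integral_mono i4.neg ((hθint.const_mul ℓ).const_mul |2 * P.γ - c|) fun x => ?_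
    have hFx0 := hF0 _ (hρ0 x)
    have hFx := hFθ _ (hρ0 x)
    calc -(a x * ((2 * P.γ - c) * F (ρ x))) ≤ |a x * ((2 * P.γ - c) * F (ρ x))| := neg_le_abs _
      _ = a x * (|2 * P.γ - c| * F (ρ x)) := by
          rw [abs_mul, abs_mul, abs_of_nonneg (ha0 x), abs_of_nonneg hFx0]
      _ ≤ 1 * (|2 * P.γ - c| * F (ρ x)) :=
          mul_le_mul_of_nonneg_right (ha1 x) (mul_nonneg (abs_nonneg _) hFx0)
      _ ≤ |2 * P.γ - c| * (ℓ * θ (ρ x)) := by rw [one_mul]; exact mul_le_mul_of_nonneg_left hFx (abs_nonneg _)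
  have hb4 : ∫ x, a x * (F' (ρ x) * g x) ≤ ∫ x, a x * (|F' (ρ x)| * |g x|) := by
    refine integral_mono i5 i6 fun x => ?_
    refine mul_le_mul_of_nonneg_left ?_ (ha0 x)
    rw [← abs_mul]; exact le_abs_self _
  rw [integral_const_mul, integral_const_mul] at hb1 hb2 hb3
  have : K * (ℓ * ∫ x, θ (ρ x)) + |c| * (ℓ * ∫ x, θ (ρ x)) + |2 * P.γ - c| * (ℓ * ∫ x, θ (ρ x)) =
      ℓ * (K + |c| + |2 * P.γ - c|) * ∫ x, θ (ρ x) := by ring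
  linarith

/-- Registered helper (notation-free restatement of `flip_revGenerator_add_eq_zero_of_weak`). -/
theorem helper_flipRevGeneratorOfWeak : ∀ (N : ℕ) (P : Literature.MathematicalPhysics.KineticTheory.HeatConduction.OscillatorChain), ContDiff ℝ ((⊤ : ℕ∞) : WithTop ℕ∞) P.U → ContDiff ℝ ((⊤ : ℕ∞) : WithTop ℕ∞) P.V → 0 < N → ∀ (T_L T_R : ℝ), 0 ≤ P.γ * T_L → 0 ≤ P.γ * T_R → ∀ (ε : ℝ) (ρ : Literature.MathematicalPhysics.KineticTheory.HeatConduction.PhaseSpace N → ℝ), ContDiff ℝ 2 ρ → (∀ φ : Literature.MathematicalPhysics.KineticTheory.HeatConduction.PhaseSpace N → ℝ, ContDiff ℝ ((⊤ : ℕ∞) : WithTop ℕ∞) φ → HasCompactSupport φ → MeasureTheory.integral MeasureTheory.volume (fun x => P.flipGenerator N T_L T_R ε φ x * ρ x) = 0) → ∀ x : Literature.MathematicalPhysics.KineticTheory.HeatConduction.PhaseSpace N, Literature.MathematicalPhysics.KineticTheory.sdeGenerator (fun y => -P.drift N y) (P.bathVecL N T_L) (P.bathVecR N T_R) ρ x +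 2 * P.γ * ρ x + ε * Literature.MathematicalPhysics.KineticTheory.HeatConduction.flipNoise N ρ x = 0 :=
  fun _ P hU hV hN _ _ hL hR ε _ hρ hweak x => flip_revGenerator_add_eq_zero_of_weak P hU hV hN hL hR ε hρ hweak x

end Summit.AtomisticToContinuum.FouriersLaw.Theorems.NoisyFourier.FlipResolvent

end
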